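import Literature.NumberTheory.EllipticCurves.Sprung2012.ColemanMapJointInjectiveProofs
import Summits.BirchSwinnertonDyer.BirchSwinnertonDyer.Theorems.ByReductionTypeAtTwoSupersingularFlatColemanLinearOfTraces
import Summits.BirchSwinnertonDyer.Rank1Residual.F1Sign2.HondaSystemAtTwo
import Literature.NumberTheory.EllipticCurves.Kato2004.IwasawaH1LambdaTorsionFreeProofs
import Literature.NumberTheory.EllipticCurves.IwasawaAlgebraDivisibilityProofs
import HarnessLib

/-!
# Route `ByReductionTypeAtTwo` (rung K4), crux `SupersingularRankZeroAtTwo` (item stmt-BirchSwinnertonDyer-19097), line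
# `odd_blind_package` v2.19, stub 3/5 `stub_flatPackage`, conjunct (8), clause F3 — **FILE Z1 of hand hF3-ZETA: the
# localisation `pairFun` and `loc♭ = Col♭ ∘ pairFun` are INJECTIVE on `𝐇¹_Γ(T_pW)` as soon as ONE class has a non-zero ♭
# Coleman value; and the JOINT COLEMAN MAP IS INJECTIVE AT `p = 2`** (cell `bsd-2adic`, seat `bsd-2adic-t42` GEN 51;
# `--supports 19097`, helper)

HONEST FRAMING (D-0054): THEOREMS ONLY — no definition, no named fact, no instance, no `sorry`.  CONSUMER algebra over
displayed hypotheses.  Helper toward conjunct (8) F3/ZL2 of `FlatCKPackageAtTwo`; closes NO stub; 19097 stays OPEN on its 5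
registered stubs; nothing booked; BSD₂ is proved for no supersingular curve and BSD for no curve by any of this; typed ≠ proved.

## What and why

The F3 package pins a generator `s₀` of the zeta line `Z ⊂ 𝐇¹ = I.H` by levelwise congruences for the pairing sums
`P_{n,c_n}(pairFun s)` (hand hF3-ZETA files Z2–Z5).  To pull identities of functionals / of Coleman values back to identities
in `𝐇¹` one needs the localisation to be injective.  Two independent facts are proved here.

* §1 (`p = 2`, any base, any Honda system AT TWO).  **Joint Coleman injectivity**: a functional `z` on `E(K_∞·K_v)` with
  `ω_n ∣ P_{n,c_n}(z)` for every `n` vanishes (`eq_zero_of_forall_omega_dvd_pairingSum_two`) — hence Coleman value `(0,0)`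
  forces `z = 0`, two functionals with the same Coleman value coincide, any `Λ`-linear `J` carrying the Coleman values
  (`OddBlindNF.exists_linearMap_isColemanPair_of_traces`) is injective, and the points-model `H¹_Iw(T₂W)` (with
  `Sprung2012.moduleOfGenerator`) is `Λ`-TORSION-FREE.  The proof is the tree's odd-`p` `Sprung2012.IsColemanPair.eq_zero_of_pair_zero`
  VERBATIM: it uses only the levels `c_n ∈ E(K_n·K_v)` and the dual generation clause (vii) of
  `F1Sign2.IsHondaSystemAtTwo` (identical to the odd-`p` clause), never the bottom relations that differ at `2`.
* §2 (any domain `R`).  **Injectivity on a rank-`≤ 1` source**: for `H` torsion-free of `R`-rank `≤ 1` (Kato Thm. 12.4 (2) for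
  `𝐇¹`: tree `IwasawaH1Data.isTorsionFree` + the `rank ≤ 1` clause of `Kato2004.thm12_4`, displayed) and linear
  `L : H → N`, `φ : N → R` with `φ (L s) ≠ 0` for ONE `s`, both `φ ∘ L` and `L` are injective
  (`Literature.NumberTheory.EllipticCurves.Module.injective_of_rank_le_one`, Kato §17.13).  No torsion-freeness of `N` is needed.
* §3 (the pin).  ★ `pairFun_injective_of_flat_ne_zero`: for `I : Kato2004.IwasawaH1Data W p κ γ`, `hrank : Module.rank Λ I.H ≤ 1`,
  any `Λ`-linear `L : I.H → (E(ℚ_∞·ℚ_v) →+ ℤ_p)` (the `pairFun` of p830262) and `J` (the Coleman map), ONE class `s` with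
  `(J (L s)).2 ≠ 0` (F3b: `Col♭(L s₀) = r·L♭ ≠ 0`) makes `L` and `loc♭ := snd ∘ J ∘ L` injective.

References: [Sprung2012] F. Sprung, J. Number Theory 132 (2012), Thm. 2.2, Cor. 2.10, Prop. 5.5, Def. 5.9, Def. 7.1;
[Kato2004Asterisque] K. Kato, Astérisque 295 (2004), Thm. 12.4 (2) (p. 221), §17.13 (p. 279); [KuriharaPollack2007] Prop. 1.2;
[LeiSujatha2021] §3 (SES-KP).
-/

set_option autoImplicit false
-- the Theorems namespace of this sub repeats the summit name by design (D-0017 nested layout)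
set_option linter.dupNamespace false

noncomputable section

open scoped Classical NumberField

open Polynomial

universe u

namespace Summit.BirchSwinnertonDyer.BirchSwinnertonDyer.Theorems

namespace SSFlatPackage

open NumberField IsDedekindDomain WeierstrassCurve Literature.NumberTheory.EllipticCurves
  Literature.NumberTheory.EllipticCurves.ZpExtension Literature.NumberTheory.EllipticCurves.Sprung2017
  Literature.NumberTheory.EllipticCurves.Kobayashi2003 Literature.NumberTheory.EllipticCurves.Sprung2012
  Literature.NumberTheory.GaloisRepresentations

/-! ## §1 Joint Coleman injectivity AT `p = 2` (levels + clause (vii) of `IsHondaSystemAtTwo`) -/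

section Two

variable {K : Type u} [Field K] {κ : ZpExtension K 2}
variable {E : Type u} [Field E] [Algebra K E] {ι : AlgebraicClosure K →ₐ[K] AlgebraicClosure E}
variable {W : WeierstrassCurve K}

/-- **`ω_n ∣ P_{n,c_n}(z)` for every `n` forces `z = 0`**, for a Honda system AT TWO.  Level raising
`P_{n+1,c_n}(z) = Φ_{2^{n+1}}(1+T)·P_{n,c_n}(z)` (`thetaPoly_succ_of_mem_layer`) gives `ω_{n+1} ∣ P_{n+1,c_n}(z)`, so the dual
generation clause (vii) at level `n+1` kills `z` on `E(K_{n+1}·K_v)`; every point has a level.  (The tree's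
`Sprung2012.IsColemanPair.eq_zero_of_pair_zero` for `p = 2`: same proof, clause (vii) is the same token.)
[cite: Sprung2012, Thm. 2.2 and Cor. 2.10 (pp. 1487–1489), Def. 5.9 (p. 1495)] [cite: KuriharaPollack2007, Prop. 1.2] -/
theorem eq_zero_of_forall_omega_dvd_pairingSum_two {g : Field.absoluteGaloisGroup E}
    (hg : κ.IsTopGenerator (resGalOfEmb ι g)) {ap : ℤ} {cneg : localPoints W E} {c : ℕ → localPoints W E}
    (hH : Summit.BirchSwinnertonDyer.Rank1Residual.F1Sign2.IsHondaSystemAtTwo κ ι W ap g cneg c)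
    {z : localTowerPointsOfEmb κ ι W →+ ℤ_[2]}
    (hθ : ∀ n, toIwasawa 2 (cyclotomicOmega 2 n) ∣ pairingSum W (localTowerPointsOfEmb κ ι W) g n (c n) z) :
    z = 0 := by
  -- adapted from Literature/NumberTheory/EllipticCurves/Sprung2012/ColemanMapJointInjectiveProofs.lean
  obtain ⟨-, hcn, -, -, -, -, -, hgen, -⟩ := hH
  -- `ω_{n+1} ∣ P_{n+1,c_n}(z)` (level raising)
  have hθ' : ∀ n, toIwasawa 2 (cyclotomicOmega 2 (n + 1)) ∣
      pairingSum W (localTowerPointsOfEmb κ ι W) g (n + 1) (c n) z := by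
    intro n
    rw [← coe_thetaPoly, thetaPoly_succ_of_mem_layer κ ι W hg (hcn n) z, Polynomial.coe_mul, cyclotomicOmega_succ,
      map_mul]
    have hΦ : toIwasawa 2 ((cyclotomic (2 ^ (n + 1)) ℤ).comp (X + 1)) =
        ((((cyclotomic (2 ^ (n + 1)) ℤ).comp (X + 1)).map (Int.castRingHom ℤ_[2]) : ℤ_[2][X]) : PowerSeries ℤ_[2]) :=
      rfl
    rw [hΦ, mul_comm, coe_thetaPoly]
    exact mul_dvd_mul_left _ (hθ n)
  -- the restriction of `z` to each layer `n + 1` vanishes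
  have hlayer : ∀ n, z.comp (AddSubgroup.inclusion (localLayerPointsOfEmb_le_localTowerPointsOfEmb κ ι W (n + 1))) = 0 := by
    intro n
    refine hgen (n + 1) (Nat.le_add_left 1 n) _ ?_ ?_
    · rw [pairingSum_comp_inclusion κ ι W (n + 1) (hcn (n + 1))]
      exact hθ (n + 1)
    · rw [Nat.add_sub_cancel,
        pairingSum_comp_inclusion κ ι W (n + 1) (localLayerPointsOfEmb_mono κ ι W (Nat.le_succ n) (hcn n))]
      exact hθ' n
  ext P
  obtain ⟨n, hn⟩ := exists_mem_localLayerPointsOfEmb_of_mem_localTowerPointsOfEmb κ ι W P.2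
  have hn1 : (P : localPoints W E) ∈ localLayerPointsOfEmb κ ι W (n + 1) :=
    localLayerPointsOfEmb_mono κ ι W (Nat.le_succ n) hn
  have h := DFunLike.congr_fun (hlayer n) ⟨P, hn1⟩
  rw [AddMonoidHom.comp_apply, AddMonoidHom.zero_apply] at h
  rw [AddMonoidHom.zero_apply, ← h]
  rfl

/-- **Coleman value `(0, 0)` forces `z = 0`** at `p = 2` (`IsColemanPair … z 0 0` reads `ω_n ∣ P_{n,c_n}(z)` for all `n`).
[cite: Sprung2012, Def. 5.9 (p. 1495), Cor. 2.10 (p. 1489)] [cite: LeiSujatha2021, §3 (SES-KP)] -/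
theorem eq_zero_of_isColemanPair_zero_two {g : Field.absoluteGaloisGroup E}
    (hg : κ.IsTopGenerator (resGalOfEmb ι g)) {ap : ℤ} {cneg : localPoints W E} {c : ℕ → localPoints W E}
    (hH : Summit.BirchSwinnertonDyer.Rank1Residual.F1Sign2.IsHondaSystemAtTwo κ ι W ap g cneg c)
    {z : localTowerPointsOfEmb κ ι W →+ ℤ_[2]} (hz : IsColemanPair κ ι W ap g c z 0 0) : z = 0 :=
  eq_zero_of_forall_omega_dvd_pairingSum_two hg hH fun n ↦ by simpa only [mul_zero, add_zero] using hz n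

/-- **Two functionals with the same Coleman value coincide** at `p = 2`. [cite: Sprung2012, Def. 5.9 (p. 1495), Def. 7.1 (p. 1500)] -/
theorem isColemanPair_functional_unique_two {g : Field.absoluteGaloisGroup E}
    (hg : κ.IsTopGenerator (resGalOfEmb ι g)) {ap : ℤ} {cneg : localPoints W E} {c : ℕ → localPoints W E}
    (hH : Summit.BirchSwinnertonDyer.Rank1Residual.F1Sign2.IsHondaSystemAtTwo κ ι W ap g cneg c)
    {z z' : localTowerPointsOfEmb κ ι W →+ ℤ_[2]} {Lsharp Lflat : IwasawaAlgebra 2}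
    (hz : IsColemanPair κ ι W ap g c z Lsharp Lflat) (hz' : IsColemanPair κ ι W ap g c z' Lsharp Lflat) : z = z' := by
  have h := hz.sub hz'
  rw [sub_self, sub_self] at h
  exact sub_eq_zero.mp (eq_zero_of_isColemanPair_zero_two hg hH h)

/-- **The joint Coleman map `J : H¹_Iw(T) → Λ × Λ` is injective** at `p = 2` (the usual shape: `J z = (Col♯ z, Col♭ z)`).
[cite: Sprung2012, Def. 5.9 (p. 1495), Def. 7.1 (p. 1500)] [cite: LeiSujatha2021, §3 (SES-KP)] -/
theorem colemanPairMap_injective_two {g : Field.absoluteGaloisGroup E}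
    (hg : κ.IsTopGenerator (resGalOfEmb ι g)) {ap : ℤ} {cneg : localPoints W E} {c : ℕ → localPoints W E}
    (hH : Summit.BirchSwinnertonDyer.Rank1Residual.F1Sign2.IsHondaSystemAtTwo κ ι W ap g cneg c)
    (J : (localTowerPointsOfEmb κ ι W →+ ℤ_[2]) → IwasawaAlgebra 2 × IwasawaAlgebra 2)
    (hJ : ∀ z, IsColemanPair κ ι W ap g c z (J z).1 (J z).2) : Function.Injective J := by
  intro z z' h
  have hz' : IsColemanPair κ ι W ap g c z' (J z).1 (J z).2 := by rw [h]; exact hJ z'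
  exact isColemanPair_functional_unique_two hg hH (hJ z) hz'

/-- **The points-model `H¹_Iw(T₂W)` is `Λ`-torsion-free at `2`**: with the `Λ`-structure `Sprung2012.moduleOfGenerator κ ι W hg`
and a `Λ`-LINEAR `J` carrying the Coleman values (`OddBlindNF.exists_linearMap_isColemanPair_of_traces`), `f • z = 0` forces
`f = 0 ∨ z = 0` — pull back torsion-freeness of `Λ × Λ` along the injective `J`.  (A THEOREM concluding the `Prop`-class; no
instance is declared.) [cite: Sprung2012, Def. 5.9 (p. 1495)] [cite: Kato2004Asterisque, Thm. 12.4 (2) (p. 221) (global analogue)] -/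
theorem isTorsionFree_functionals_two {g : Field.absoluteGaloisGroup E}
    (hg : κ.IsTopGenerator (resGalOfEmb ι g)) {ap : ℤ} {cneg : localPoints W E} {c : ℕ → localPoints W E}
    (hH : Summit.BirchSwinnertonDyer.Rank1Residual.F1Sign2.IsHondaSystemAtTwo κ ι W ap g cneg c)
    (J : letI := moduleOfGenerator κ ι W hg
      (localTowerPointsOfEmb κ ι W →+ ℤ_[2]) →ₗ[IwasawaAlgebra 2] IwasawaAlgebra 2 × IwasawaAlgebra 2)
    (hJ : ∀ z, IsColemanPair κ ι W ap g c z (J z).1 (J z).2) :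
    letI := moduleOfGenerator κ ι W hg
    Module.IsTorsionFree (IwasawaAlgebra 2) (localTowerPointsOfEmb κ ι W →+ ℤ_[2]) := by
  letI := moduleOfGenerator κ ι W hg
  exact Function.Injective.moduleIsTorsionFree J (colemanPairMap_injective_two hg hH J hJ) (fun f z ↦ map_smul J f z)

end Two

/-! ## §2 Injectivity out of a torsion-free module of rank `≤ 1` (any domain) -/

section RankOne

variable {R : Type*} [CommRing R] [IsDomain R] {H N : Type*} [AddCommGroup H] [Module R H] [AddCommGroup N] [Module R N]

/-- **A linear map out of a torsion-free rank-`≤ 1` module whose composite with some linear form is non-zero at one element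
is injective, and so is the composite.**  (`Module.injective_of_rank_le_one` with the non-torsion witness `φ (L s) ≠ 0` in the
domain `R`; Kato §17.13 «since `𝐇¹` has no `Λ`-torsion and is of `Λ`-rank 1, it is sufficient …».)
[cite: Kato2004Asterisque, §17.13 (p. 279)] -/
theorem injective_and_injective_comp_of_rank_le_one [Module.IsTorsionFree R H] (hH : Module.rank R H ≤ 1)
    (L : H →ₗ[R] N) (φ : N →ₗ[R] R) (s : H) (hs : φ (L s) ≠ 0) :
    Function.Injective L ∧ Function.Injective (φ ∘ₗ L) := by
  have hcomp : Function.Injective (φ ∘ₗ L) :=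
    Literature.NumberTheory.EllipticCurves.Module.injective_of_rank_le_one hH (φ ∘ₗ L) s fun a ha ↦ by
      rw [LinearMap.comp_apply, smul_eq_mul] at ha
      exact (mul_eq_zero.mp ha).resolve_right hs
  refine ⟨fun x y hxy ↦ hcomp ?_, hcomp⟩
  simp only [LinearMap.comp_apply, hxy]

/-- The same with the linear form valued in a product `M × R` and read in the second coordinate (the shape of the joint Coleman
map `J : H¹_Iw → Λ × Λ`, `loc♭ = snd ∘ J ∘ L`). [cite: Kato2004Asterisque, §17.13 (p. 279)] -/
theorem injective_and_injective_snd_comp_of_rank_le_one [Module.IsTorsionFree R H] (hH : Module.rank R H ≤ 1)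
    {M : Type*} [AddCommGroup M] [Module R M]
    (L : H →ₗ[R] N) (J : N →ₗ[R] M × R) (s : H) (hs : (J (L s)).2 ≠ 0) :
    Function.Injective L ∧ Function.Injective ((LinearMap.snd R M R ∘ₗ J) ∘ₗ L) :=
  injective_and_injective_comp_of_rank_le_one hH L (LinearMap.snd R M R ∘ₗ J) s (by simpa using hs)

end RankOne

/-! ## §3 The pin: `pairFun` and `loc♭ = Col♭ ∘ pairFun` are injective on `𝐇¹_Γ(T_pW)` -/

section Pin

variable (W : WeierstrassCurve ℚ) [W.IsElliptic] {p : ℕ} [Fact p.Prime] [ContinuousSMul ℤ_[p] (W.tateModule p)]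
  (κ : ZpExtension ℚ p) {γ : Field.absoluteGaloisGroup ℚ} (v : HeightOneSpectrum (𝓞 ℚ))
  {g : Field.absoluteGaloisGroup (v.adicCompletion ℚ)}

/-- ★ **`pairFun` and `loc♭ := Col♭ ∘ pairFun` are injective on `𝐇¹_Γ(T_pW)` as soon as ONE class has a non-zero ♭ Coleman
value.**  For the pin `I : Kato2004.IwasawaH1Data W p κ γ` (torsion-free: `IwasawaH1Data.isTorsionFree`, Kato Thm. 12.4 (2)), the
displayed `rank ≤ 1` clause of Thm. 12.4 (2) (`Kato2004.thm12_4`, a conjunct of `stub_pub`), ANY `Λ`-linear localisation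
`L : I.H → (E(ℚ_∞·ℚ_v) →+ ℤ_p)` (p830262 `exists_linearMap_pairFun_tatePairing`) and ANY `Λ`-linear `J` into `Λ × Λ` (the
Coleman map of `OddBlindNF.exists_linearMap_isColemanPair_of_traces`), one `s` with `(J (L s)).2 ≠ 0` (in the F3 package:
`Col♭(pairFun s₀) = r·L♭`, `L♭ ≠ 0` by `SSFlatRoad.flat_ne_zero_two`) gives `Injective L ∧ Injective (snd ∘ J ∘ L)`.
[cite: Kato2004Asterisque, Thm. 12.4 (2) (p. 221) and §17.13 (p. 279)] [cite: Sprung2012, Def. 5.9 (p. 1495)] -/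
theorem pairFun_injective_of_flat_ne_zero (hγ : κ.IsTopGenerator γ)
    (hg : κ.IsTopGenerator (resGalOfEmb (closureEmb (K := ℚ) (v.adicCompletion ℚ)) g))
    (I : Kato2004.IwasawaH1Data W p κ γ) (hrank : Module.rank (IwasawaAlgebra p) I.H ≤ 1)
    (L : letI := moduleOfGenerator κ (closureEmb (K := ℚ) (v.adicCompletion ℚ)) W hg
      I.H →ₗ[IwasawaAlgebra p] (localTowerPointsOfEmb κ (closureEmb (K := ℚ) (v.adicCompletion ℚ)) W →+ ℤ_[p]))
    (J : letI := moduleOfGenerator κ (closureEmb (K := ℚ) (v.adicCompletion ℚ)) W hg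
      (localTowerPointsOfEmb κ (closureEmb (K := ℚ) (v.adicCompletion ℚ)) W →+ ℤ_[p]) →ₗ[IwasawaAlgebra p]
        IwasawaAlgebra p × IwasawaAlgebra p)
    (s : I.H) (hs : (J (L s)).2 ≠ 0) :
    letI := moduleOfGenerator κ (closureEmb (K := ℚ) (v.adicCompletion ℚ)) W hg
    Function.Injective L ∧
      Function.Injective ((LinearMap.snd (IwasawaAlgebra p) (IwasawaAlgebra p) (IwasawaAlgebra p) ∘ₗ J) ∘ₗ L) := by
  letI := moduleOfGenerator κ (closureEmb (K := ℚ) (v.adicCompletion ℚ)) W hg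
  haveI := I.isTorsionFree hγ
  exact injective_and_injective_snd_comp_of_rank_le_one hrank L J s hs

end Pin

end SSFlatPackage

end Summit.BirchSwinnertonDyer.BirchSwinnertonDyer.Theorems

end
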